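/-
Copyright (c) 2026 the pub-hodgecm-mathlib formalisation cell (harness21).  Prover seat hodgecm-mathlib-LH4-p05 (g8), Track A «(D-RAM) FOUR-FRAME» squad, helper lane on
h413 = stmt-HodgeConjecture-24833 (count-neutral).  Heir dealer∕pen LH4-plan (g13) WORD #96 (2) «LH4-p05 OWNS the TABLE assembly»; the assembly's first move: the Stage-B
table identity (SIG-B2b3 v1, LH4-p11 (g8)) in STRATUM (box) form.  2026-09-04.
-/
import Summits.HodgeConjecture.HodgeConjecture.Theorems.F0P3cDyRamCleanSgnOfOddTable              -- ★ (this seat): `dyadicFence_cleanSgnFrameConstLawAt_derived_ofRecord_of_table` (stub type ⇐ TABLE); brings ★ p860462 (A_L), ★ DEFS p860257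
import Summits.HodgeConjecture.HodgeConjecture.Theorems.F0P3cDyRamLabelledKappaStrataPartition     -- ★ (LH4-p12 (g7)): `finsum_mem_sep_eq_sum_box_finsum_stratum_sep`, `finsum_stratum_sep_eq_zero_of_not_shape`
import HarnessLib

/-!
# Crux `H413`, line LH4 «(D-RAM) FOUR-FRAME» — THE STAGE-B TABLE OF (β-BAL) IN BOX FORM: the labelled-odd table over the clean-shell normalised stable lattices is the
# finite BOX SUM of its per-stratum tables (non-dualisable lattices weigh `0`), so SIG-B2b3 — hence `stub_law_cleanSgn` — follows from the per-stratum values summing to `0`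

Cell `hodgecm-mathlib` (D-0151), FLOOR 0, crux item H413 = `stmt-HodgeConjecture-24833`, route `HCCMUnconditional`; squad F0∕P3c∕LH4.  THEOREMS ONLY (no `def`, no instance, no
notation, no `sorry`, default heartbeats); ★-only imports; lane `--supports stmt-HodgeConjecture-24833 --as helper`; pays NO row, states NO law; import cone ∌ the (β) consumer ★ p859751.

THE MOVE (TABLE assembly, step 1).  SIG-B2b3 (LH4-p11 (g8) facc5a91 = the `hB` binder of ★ `…CleanSgnOfOddTable`): for every datum∕`u`∕element datum∕`T = diag(α,β,1)`∕slot `i`,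
`Σᶠ_{M₀ ∈ 𝓛₀(T), shell} g_i(M₀) = 0`, `g_i(M₀) := labelledOddCount σ ϖ 0 i (valueClassLabel σ ϖ (α−1) (β−1) m* d) M₀ ∕ [𝒰 : N S̃'(M₀)]`.  (§1) A normalised lattice with NO type-0
diagonal polarisation has `labelledOddCount = 0` (★ DEFS `labelledOddCount_eq_zero_of_not_exists` — the polarisation-class set is empty), so the sum may be restricted to the
DUALISABLE part of `𝓛₀(T)`; (§2) there ★ (LH4-p12) `finsum_mem_sep_eq_sum_box_finsum_stratum_sep` (axis vectors in the box `[0, n₁+n₂+n₃]³`, any label, any weight) makes it the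
BOX SUM of the per-stratum tables `Σᶠ_{M ∈ stratum(T, a), shell} g_i(M)`, of which only the ★ B3 shapes (core ∕ on-branch ∕ glued ∕ core-hanging, ★ `finsum_stratum_sep_eq_zero_of_not_shape`)
can be non-zero.  (§3) Hence **SIG-B2b3 ⇐ «for every datum the per-stratum tables sum to `0` over the box»**, and with ★ `…_of_table`, **`stub_law_cleanSgn`'s type ⇐ the same** — the
form in which the Stage-B hands deliver: per stratum (F0P3-p01 (g36) ★ p860467 one-slot cells, LH4-p11 (g8) pure cells, LH4-p13 (g8) B2b-2 + LH4-p14 (g6) ★ B3 on the two-slot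
cells), then one finite identity in `q` and the depths.
HONEST LABEL.  Count-neutral bookkeeping; the per-stratum values and their vanishing sum are OPEN (hypotheses here); table∕(β-BAL)∕(β)∕T₊ row OPEN; `HC_CM` is proved only modulo the
7 printed citations (2 remaining named inputs: hLiu418 = `stmt-HodgeConjecture-24832`, h413 = `stmt-HodgeConjecture-24833`) until rung 0 closes.

## References
* [Kottwitz1986BaseChangeUnits] R. E. Kottwitz, *Base change for unit elements of Hecke algebras*, Compositio Math. 60 (1986), §1 pp. 240–241 (signed lattice counts by strata).
* [Rogawski1990] J. D. Rogawski, *Automorphic Representations of Unitary Groups in Three Variables*, Ann. of Math. Stud. 123 (1990): §4.9 Prop. 4.9.1 (a)(b) p. 55.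
* [LanglandsShelstad1987] R. P. Langlands, D. Shelstad, *On the definition of transfer factors*, Math. Ann. 278 (1987), §1.3, §3.
-/

set_option autoImplicit false

noncomputable section

namespace Summit.HodgeConjecture.HodgeConjecture.Cruxes.H413.F0P3cDyRamLabelledOddStageBBoxForm

open Literature.NumberTheory.Automorphic Literature.NumberTheory.Automorphic.HermitianLattice Literature.NumberTheory.Automorphic.UnitaryGroup
open Literature.NumberTheory.Automorphic.UnitaryLatticeTree Literature.NumberTheory.Automorphic.UnitaryThreeFourFrame
open Summit.HodgeConjecture.HodgeConjecture.Cruxes.H413.F0P3cDyRamFourFrameLawDefs (DyadicFence)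
open Summit.HodgeConjecture.HodgeConjecture.Cruxes.H413.F0P3cDyRamFourFramePieces
open Summit.HodgeConjecture.HodgeConjecture.Cruxes.H413.F0P3cDyRamFourFrameCensusDefs
open Summit.HodgeConjecture.HodgeConjecture.Cruxes.H413.F0P3cDyRamStageOneBDefs
open Summit.HodgeConjecture.HodgeConjecture.Cruxes.H413.F0P3cDyRamStageOneBDerivedDefs
open Summit.HodgeConjecture.HodgeConjecture.Cruxes.H413.F0P3cDyRamDiagonalTorusDefs
open Summit.HodgeConjecture.HodgeConjecture.Cruxes.H413.F0P3cDyRamDiagonalStrataDefs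
open Summit.HodgeConjecture.HodgeConjecture.Cruxes.H413.F0P3cDyRamLabelledOddCountDefs
open Summit.HodgeConjecture.HodgeConjecture.Cruxes.H413.F0P3cDyRamCleanSgnOfOddTable
open Summit.HodgeConjecture.HodgeConjecture.Cruxes.H413.F0P3cDyRamLabelledKappaStrataPartition
open scoped Matrix MatrixGroups WithZero Valued

section BoxForm

variable {K : Type} [Field K] [Valued K ℤᵐ⁰] [Fintype 𝓀[K]]

/-! ## §1  Non-dualisable normalised lattices weigh zero -/

omit [Fintype 𝓀[K]] in
/-- The labelled-odd table over `𝓛₀(T) ∩ {shell}` equals the table over its DUALISABLE part: a lattice with no type-0 diagonal polarisation has an empty polarisation-class set,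
hence `labelledOddCount = 0` (★ DEFS), hence weight `0`. [cite: Kottwitz1986BaseChangeUnits, §1 pp. 240–241] -/
theorem finsum_shell_eq_finsum_dualisable_shell (σ : K →+* K) (ϖ : K) (T : GL (Fin 3) K) (Q : Submodule 𝒪[K] (Fin 3 → K) → Prop) (i : Fin 3)
    (Λ : Submodule 𝒪[K] (Fin 3 → K) → (Fin 3 → K) → Prop) :
    ∑ᶠ M₀ ∈ {M | M ∈ normalisedStableLattices T ∧ Q M},
        (labelledOddCount σ ϖ 0 i Λ M₀ : ℚ) / ((((unitStabilizer M₀).map (unitNormMap σ 3)).relIndex (fixedUnitTorus σ 3) : ℕ) : ℚ) =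
      ∑ᶠ M₀ ∈ {M | M ∈ normalisedStableLattices T ∧ IsDualisableLattice σ ϖ M ∧ Q M},
        (labelledOddCount σ ϖ 0 i Λ M₀ : ℚ) / ((((unitStabilizer M₀).map (unitNormMap σ 3)).relIndex (fixedUnitTorus σ 3) : ℕ) : ℚ) := by
  classical
  rw [finsum_mem_def, finsum_mem_def]
  refine finsum_congr fun M => ?_
  by_cases hdual : IsDualisableLattice σ ϖ M
  · simp only [Set.indicator, Set.mem_setOf_eq, hdual, true_and]
  · have h0 : labelledOddCount σ ϖ 0 i Λ M = 0 := labelledOddCount_eq_zero_of_not_exists σ ϖ 0 i Λ M hdual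
    simp only [Set.indicator, Set.mem_setOf_eq, hdual, false_and, and_false, h0, Int.cast_zero, zero_div, ite_self]

/-! ## §2  The box form -/

/-- **THE TABLE IN BOX FORM.**  At a ramified datum and an element datum `(α, β; n₁, n₂, n₃)`, `T = diag(α, β, 1)`, for ANY shell predicate `Q`, label `Λ` and slot `i`:
`Σᶠ_{M₀ ∈ 𝓛₀(T), Q} labelledOddCount…∕[𝒰 : N S̃'] = Σ_{a ∈ [0, n₁+n₂+n₃]³} Σᶠ_{M ∈ stratum(T, a), Q} labelledOddCount…∕[𝒰 : N S̃']` (§1 + ★ `finsum_mem_sep_eq_sum_box_finsum_stratum_sep`).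
[cite: Kottwitz1986BaseChangeUnits, §1 pp. 240–241] [cite: Rogawski1990, §4.9 Prop. 4.9.1 (a)(b) p. 55] -/
theorem finsum_shell_eq_sum_box_finsum_stratum {σ : K →+* K} {ϖ : K} {d t : ℕ} (hD : IsRamifiedQuadraticDatum σ ϖ d t)
    {N₀ : ℕ} {α β : K} {n₁ n₂ n₃ : ℕ} (hE : IsElementDatum σ ϖ N₀ α β n₁ n₂ n₃)
    (T : GL (Fin 3) K) (hT : (T : Matrix (Fin 3) (Fin 3) K) = Matrix.diagonal ![α, β, 1])
    (Q : Submodule 𝒪[K] (Fin 3 → K) → Prop) (i : Fin 3) (Λ : Submodule 𝒪[K] (Fin 3 → K) → (Fin 3 → K) → Prop) :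
    ∑ᶠ M₀ ∈ {M | M ∈ normalisedStableLattices T ∧ Q M},
        (labelledOddCount σ ϖ 0 i Λ M₀ : ℚ) / ((((unitStabilizer M₀).map (unitNormMap σ 3)).relIndex (fixedUnitTorus σ 3) : ℕ) : ℚ) =
      ∑ a : Fin 3 → Fin (n₁ + n₂ + n₃ + 1), ∑ᶠ M₀ ∈ {M : Submodule 𝒪[K] (Fin 3 → K) | M ∈ stratum σ ϖ T (fun j => (a j : ℕ)) ∧ Q M},
        (labelledOddCount σ ϖ 0 i Λ M₀ : ℚ) / ((((unitStabilizer M₀).map (unitNormMap σ 3)).relIndex (fixedUnitTorus σ 3) : ℕ) : ℚ) := by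
  rw [finsum_shell_eq_finsum_dualisable_shell σ ϖ T Q i Λ]
  exact finsum_mem_sep_eq_sum_box_finsum_stratum_sep hD hE T hT Q _

end BoxForm

/-! ## §3  SIG-B2b3 and `stub_law_cleanSgn`'s type from the per-stratum tables -/

/-- **SIG-B2b3 FROM THE BOX.**  If, behind the dyadic fence at every datum, for every `σ`-fixed non-norm `u` with the dichotomy, every element datum above `n0DerivedOfRecord d`,
`T = diag(α, β, 1)` and slot `i`, the BOX SUM of the per-stratum labelled-odd tables (clean shell `(d%2, mcOfRecord d)`, value-class label at `m*`) vanishes, then the TABLE identity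
SIG-B2b3 holds — verbatim the `hB` binder of ★ `…CleanSgnOfOddTable.dyadicFence_cleanSgnFrameConstLawAt_derived_ofRecord_of_table`.
[cite: Kottwitz1986BaseChangeUnits, §1 pp. 240–241] [cite: LanglandsShelstad1987, §1.3, §3] -/
theorem table_of_box
    (hbox : ∀ {K : Type} [Field K] [Valued K ℤᵐ⁰] [CompleteSpace K] [Fintype 𝓀[K]] (σ : K →+* K) (ϖ : K) (d t : ℕ),
      Valued.v (2 : K) < 1 → IsRamifiedQuadraticDatum σ ϖ d t →
      ∀ (u : K), σ u = u → Valued.v u = 1 → (¬ ∃ z : K, z * σ z = u) →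
        (∀ x : K, σ x = x → x ≠ 0 → (∃ z : K, z * σ z = x) ∨ ∃ z : K, z * σ z = u * x) →
      ∀ (α β : K) (n₁ n₂ n₃ : ℕ), IsElementDatum σ ϖ (n0DerivedOfRecord d) α β n₁ n₂ n₃ →
      ∀ (T : GL (Fin 3) K), (T : Matrix (Fin 3) (Fin 3) K) = Matrix.diagonal ![α, β, 1] →
      ∀ i : Fin 3,
        (∑ a : Fin 3 → Fin (n₁ + n₂ + n₃ + 1), ∑ᶠ M₀ ∈ {M : Submodule 𝒪[K] (Fin 3 → K) | M ∈ stratum σ ϖ T (fun j => (a j : ℕ)) ∧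
            (LatticeInLevel ϖ (d % 2) (Matrix.diagonal ![α - 1, β - 1, 0]) M ∧ ¬ LatticeInLevel ϖ (d % 2 + 1) (Matrix.diagonal ![α - 1, β - 1, 0]) M ∧
              LatticeInLevel ϖ (mcOfRecord d) (Matrix.diagonal ![(α - 1) * (α - 1), (β - 1) * (β - 1), 0]) M)},
          (labelledOddCount σ ϖ 0 i (valueClassLabel σ ϖ (α - 1) (β - 1) (mstarOfRecord d) d) M₀ : ℚ) /
            ((((unitStabilizer M₀).map (unitNormMap σ 3)).relIndex (fixedUnitTorus σ 3) : ℕ) : ℚ)) = 0) :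
    ∀ {K : Type} [Field K] [Valued K ℤᵐ⁰] [CompleteSpace K] [Fintype 𝓀[K]] (σ : K →+* K) (ϖ : K) (d t : ℕ),
      Valued.v (2 : K) < 1 → IsRamifiedQuadraticDatum σ ϖ d t →
      ∀ (u : K), σ u = u → Valued.v u = 1 → (¬ ∃ z : K, z * σ z = u) →
        (∀ x : K, σ x = x → x ≠ 0 → (∃ z : K, z * σ z = x) ∨ ∃ z : K, z * σ z = u * x) →
      ∀ (α β : K) (n₁ n₂ n₃ : ℕ), IsElementDatum σ ϖ (n0DerivedOfRecord d) α β n₁ n₂ n₃ →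
      ∀ (T : GL (Fin 3) K), (T : Matrix (Fin 3) (Fin 3) K) = Matrix.diagonal ![α, β, 1] →
      ∀ i : Fin 3,
        ∑ᶠ M₀ ∈ {M | M ∈ normalisedStableLattices T ∧
            (LatticeInLevel ϖ (d % 2) (Matrix.diagonal ![α - 1, β - 1, 0]) M ∧ ¬ LatticeInLevel ϖ (d % 2 + 1) (Matrix.diagonal ![α - 1, β - 1, 0]) M ∧
              LatticeInLevel ϖ (mcOfRecord d) (Matrix.diagonal ![(α - 1) * (α - 1), (β - 1) * (β - 1), 0]) M)},
          (labelledOddCount σ ϖ 0 i (valueClassLabel σ ϖ (α - 1) (β - 1) (mstarOfRecord d) d) M₀ : ℚ) /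
            ((((unitStabilizer M₀).map (unitNormMap σ 3)).relIndex (fixedUnitTorus σ 3) : ℕ) : ℚ) = 0 := by
  intro K _ _ _ _ σ ϖ d t h2 hD u hσu hvu hun hdich α β n₁ n₂ n₃ hE T hT i
  rw [finsum_shell_eq_sum_box_finsum_stratum hD hE T hT _ i _]
  exact hbox σ ϖ d t h2 hD u hσu hvu hun hdich α β n₁ n₂ n₃ hE T hT i

/-- **`stub_law_cleanSgn`'S TYPE FROM THE PER-STRATUM TABLES.**  The box-sum vanishing of §3 gives (β) `CleanSgnFrameConstLawAt n0DerivedOfRecord mcOfRecord` (dyadically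
fenced) at every datum — ★ `…_of_table` ∘ `table_of_box`. [cite: Rogawski1990, §4.9 Prop. 4.9.1 (a)(b) p. 55] [cite: Kottwitz1986BaseChangeUnits, §1 pp. 240–241] [cite: LanglandsShelstad1987, §1.3, §3] -/
theorem dyadicFence_cleanSgnFrameConstLawAt_derived_ofRecord_of_box
    (hbox : ∀ {K : Type} [Field K] [Valued K ℤᵐ⁰] [CompleteSpace K] [Fintype 𝓀[K]] (σ : K →+* K) (ϖ : K) (d t : ℕ),
      Valued.v (2 : K) < 1 → IsRamifiedQuadraticDatum σ ϖ d t →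
      ∀ (u : K), σ u = u → Valued.v u = 1 → (¬ ∃ z : K, z * σ z = u) →
        (∀ x : K, σ x = x → x ≠ 0 → (∃ z : K, z * σ z = x) ∨ ∃ z : K, z * σ z = u * x) →
      ∀ (α β : K) (n₁ n₂ n₃ : ℕ), IsElementDatum σ ϖ (n0DerivedOfRecord d) α β n₁ n₂ n₃ →
      ∀ (T : GL (Fin 3) K), (T : Matrix (Fin 3) (Fin 3) K) = Matrix.diagonal ![α, β, 1] →
      ∀ i : Fin 3,
        (∑ a : Fin 3 → Fin (n₁ + n₂ + n₃ + 1), ∑ᶠ M₀ ∈ {M : Submodule 𝒪[K] (Fin 3 → K) | M ∈ stratum σ ϖ T (fun j => (a j : ℕ)) ∧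
            (LatticeInLevel ϖ (d % 2) (Matrix.diagonal ![α - 1, β - 1, 0]) M ∧ ¬ LatticeInLevel ϖ (d % 2 + 1) (Matrix.diagonal ![α - 1, β - 1, 0]) M ∧
              LatticeInLevel ϖ (mcOfRecord d) (Matrix.diagonal ![(α - 1) * (α - 1), (β - 1) * (β - 1), 0]) M)},
          (labelledOddCount σ ϖ 0 i (valueClassLabel σ ϖ (α - 1) (β - 1) (mstarOfRecord d) d) M₀ : ℚ) /
            ((((unitStabilizer M₀).map (unitNormMap σ 3)).relIndex (fixedUnitTorus σ 3) : ℕ) : ℚ)) = 0) :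
    ∀ {K : Type} [Field K] [Valued K ℤᵐ⁰] [CompleteSpace K] [Fintype 𝓀[K]] (σ : K →+* K) (ϖ : K) (d t : ℕ),
      DyadicFence (K := K) (CleanSgnFrameConstLawAt n0DerivedOfRecord mcOfRecord σ ϖ d t) :=
  dyadicFence_cleanSgnFrameConstLawAt_derived_ofRecord_of_table (table_of_box hbox)

end Summit.HodgeConjecture.HodgeConjecture.Cruxes.H413.F0P3cDyRamLabelledOddStageBBoxForm

end
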